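import Literature.Analysis.OperatorTheory.SlabFibreContraction
import Literature.Analysis.OperatorTheory.PathKernelDomination
import HarnessLib

/-!
# Slab contraction on a cyclic kernel chain WITHOUT fibre variables — PROVED

Topic `Literature/Analysis/OperatorTheory`; companion of `SlabFibreContraction.lean` (written for crux `FibreAnchor`, route
`QuantumFields/ContractibleFibre`, stub `stub_traceFormulaClustering`; Mathlib + companions only, no definitions).  The
path-space side of the clustering of a cyclic kernel chain: the cyclic integrals over `ZMod N` with slab
observables are brought to the heterogeneous cyclic integrals on `Fin _` with CONTRACTED BLOCK KERNELS
`X_α(u,u') = ∫ α(u ∷ v :: u') ∏ᵢ K dμ^{⊗r}(v)` consumed by the spectral side.  Everything is the fibred toolkit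
`SlabFibreContraction` (`slab_cyclic_zero/one/two`, `slab_blockKernel_*`) specialised to the TRIVIAL fibre
`Γ = Unit`, `ν = δ_()`, `c(x, γ, x') = K(x, x')` (`integral_prod_unit` removes the fibre factor), plus the rotation
invariance of the cyclic integral (`integral_pi_zmod_comp_sub`, `integral_pi_zmod_comp_add`, `prod_zmod_comp_sub`,
`prod_zmod_comp_add`) and the window form of a slab-local observable (`exists_window_of_local`).  [folklore]
-/

set_option autoImplicit false

noncomputable section

namespace Literature.Analysis.OperatorTheory

open scoped BigOperators
open _root_.MeasureTheory Filter Set Function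

variable {X : Type*} [MeasurableSpace X] {μ : Measure X} [IsProbabilityMeasure μ]

/-! ### The trivial fibre -/

/-- Integrating a function of the slice variables only against slices ⊗ trivial fibres. [folklore] -/
theorem integral_prod_unit {N : ℕ} [NeZero N] (Ψ : (ZMod N → X) → ℝ) :
    ∫ p : (ZMod N → X) × (ZMod N → Unit), Ψ p.1
        ∂((Measure.pi fun _ => μ).prod (Measure.pi fun _ => Measure.dirac ())) =
      ∫ V, Ψ V ∂(Measure.pi fun _ => μ) := by
  rw [integral_fun_fst, probReal_univ, one_smul]

variable {K : X → X → ℝ} {Cc : ℝ}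

omit [IsProbabilityMeasure μ] in
/-- The one-step weight `c(x, γ, x') = K(x, x')` on the trivial fibre is jointly measurable. [folklore] -/
theorem measurable_trivialFibre (hK : Measurable (uncurry K)) :
    Measurable (fun q : X × Unit × X => (fun x (_ : Unit) x' => K x x') q.1 q.2.1 q.2.2) :=
  hK.comp (measurable_fst.prodMk (measurable_snd.comp measurable_snd))

/-! ### The contracted block kernel -/

section Block

variable {r : ℕ} {α : (Fin (r + 2) → X) → ℝ}

omit [IsProbabilityMeasure μ] in
/-- A window observable, seen as a fibred block observable ignoring the (trivial) fibres, is measurable. [folklore] -/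
theorem measurable_window_fst (hα : Measurable α) :
    Measurable (fun q : (Fin (r + 2) → X) × (Fin (r + 1) → Unit) => (fun W (_ : Fin (r + 1) → Unit) => α W) q.1 q.2) :=
  hα.comp measurable_fst

/-- **(a) Joint strong measurability of the contracted block kernel**
`X_α(u,u') = ∫ α(u ∷ v :: u') ∏ᵢ K((u ∷ v :: u')ᵢ, (u ∷ v :: u')ᵢ₊₁) dμ^{⊗r}(v)`. [folklore] -/
theorem blockKernel_stronglyMeasurable (hK : Measurable (uncurry K)) (hα : Measurable α) :
    StronglyMeasurable (uncurry fun u u' : X => ∫ v : Fin r → X, α (Fin.cons u (Fin.snoc v u')) *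
      ∏ i : Fin (r + 1), K ((Fin.cons u (Fin.snoc v u') : Fin (r + 2) → X) (Fin.castSucc i))
        ((Fin.cons u (Fin.snoc v u') : Fin (r + 2) → X) (Fin.succ i)) ∂(Measure.pi fun _ => μ)) := by
  have h := slab_blockKernel_stronglyMeasurable (μ := μ) (ν := Measure.dirac ()) (c := fun x (_ : Unit) x' => K x x')
    (r := r) (α := fun W (_ : Fin (r + 1) → Unit) => α W) (measurable_trivialFibre hK) (measurable_window_fst hα)
  simp only [integral_const, probReal_univ, one_smul] at h
  exact h

/-- **(b) Domination of the contracted block kernel** by the `(r+1)`-step path kernel of `K` (`|α| ≤ 1`, `K ≥ 0`).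
[folklore] -/
theorem blockKernel_abs_le (hK : Measurable (uncurry K)) (hKb : ∀ x x', 0 ≤ K x x' ∧ K x x' ≤ Cc)
    (hαb : ∀ W, |α W| ≤ 1) (u u' : X) :
    |∫ v : Fin r → X, α (Fin.cons u (Fin.snoc v u')) *
      ∏ i : Fin (r + 1), K ((Fin.cons u (Fin.snoc v u') : Fin (r + 2) → X) (Fin.castSucc i))
        ((Fin.cons u (Fin.snoc v u') : Fin (r + 2) → X) (Fin.succ i)) ∂(Measure.pi fun _ => μ)| ≤
      1 * (∫ v : Fin r → X, ∏ i : Fin (r + 1), K ((Fin.cons u (Fin.snoc v u') : Fin (r + 2) → X) (Fin.castSucc i))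
        ((Fin.cons u (Fin.snoc v u') : Fin (r + 2) → X) (Fin.succ i)) ∂(Measure.pi fun _ => μ)) := by
  have h := slab_blockKernel_abs_le (μ := μ) (ν := Measure.dirac ()) (r := r) (α := fun W (_ : Fin (r + 1) → Unit) => α W)
    (measurable_trivialFibre hK) (fun x (_ : Unit) x' => hKb x x') (fun W _ => hαb W) u u'
  simp only [integral_const, probReal_univ, one_smul] at h
  exact h

/-- **(b') The crude bound** `|X_α(u,u')| ≤ C_c^{r+1}`. [folklore] -/
theorem blockKernel_abs_le' (hK : Measurable (uncurry K)) (hKb : ∀ x x', 0 ≤ K x x' ∧ K x x' ≤ Cc)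
    (hαb : ∀ W, |α W| ≤ 1) (u u' : X) :
    |∫ v : Fin r → X, α (Fin.cons u (Fin.snoc v u')) *
      ∏ i : Fin (r + 1), K ((Fin.cons u (Fin.snoc v u') : Fin (r + 2) → X) (Fin.castSucc i))
        ((Fin.cons u (Fin.snoc v u') : Fin (r + 2) → X) (Fin.succ i)) ∂(Measure.pi fun _ => μ)| ≤ 1 * Cc ^ (r + 1) := by
  have h := slab_blockKernel_abs_le' (μ := μ) (ν := Measure.dirac ()) (r := r) (α := fun W (_ : Fin (r + 1) → Unit) => α W)
    (measurable_trivialFibre hK) (fun x (_ : Unit) x' => hKb x x') (fun W _ => hαb W) u u'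
  simp only [integral_const, probReal_univ, one_smul] at h
  exact h

end Block

/-! ### The cyclic integrals with no / one / two slabs -/

/-- **No slab**: the `K`-cycle over `ZMod N` is the `K`-cycle over `Fin N` (`N = k + 2`). [folklore] -/
theorem cyclic_zero_noFibre (hK : Measurable (uncurry K)) (hKb : ∀ x x', 0 ≤ K x x' ∧ K x x' ≤ Cc) {N k : ℕ} [NeZero N]
    (hN : N = k + 2) :
    ∫ V : ZMod N → X, ∏ t, K (V t) (V (t + 1)) ∂(Measure.pi fun _ => μ) =
      ∫ V : Fin (k + 2) → X, ∏ t : Fin (k + 2), K (V t) (V (t + 1)) ∂(Measure.pi fun _ => μ) := by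
  have h := slab_cyclic_zero (μ := μ) (ν := Measure.dirac ()) (measurable_trivialFibre hK) (fun x (_ : Unit) x' => hKb x x')
    (k := k + 1) hN
  rw [integral_prod_unit (μ := μ) (fun V : ZMod N → X => ∏ t, K (V t) (V (t + 1)))] at h
  simp only [integral_const, probReal_univ, one_smul] at h
  exact h

/-- **One slab** at the sites `0, …, r+1` of `ZMod N`, `N = M + r + 2`: the cyclic integral is the one-insertion cycle
with the contracted block kernel on bond `0`. [folklore] -/
theorem cyclic_one_noFibre (hK : Measurable (uncurry K)) (hKb : ∀ x x', 0 ≤ K x x' ∧ K x x' ≤ Cc) {r : ℕ}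
    {α : (Fin (r + 2) → X) → ℝ} (hα : Measurable α) (hαb : ∀ W, |α W| ≤ 1) {N M : ℕ} [NeZero N]
    (hN : N = M + r + 2) :
    ∫ V : ZMod N → X, α (fun i : Fin (r + 2) => V ((i : ℕ) : ZMod N)) * ∏ t, K (V t) (V (t + 1))
        ∂(Measure.pi fun _ => μ) =
      ∫ V : Fin (1 + M + 1) → X, (fun u u' : X => ∫ v : Fin r → X, α (Fin.cons u (Fin.snoc v u')) *
          ∏ i : Fin (r + 1), K ((Fin.cons u (Fin.snoc v u') : Fin (r + 2) → X) (Fin.castSucc i))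
            ((Fin.cons u (Fin.snoc v u') : Fin (r + 2) → X) (Fin.succ i)) ∂(Measure.pi fun _ => μ)) (V 0) (V 1) *
        ∏ t : Fin (1 + M), K (V t.succ) (V (t.succ + 1)) ∂(Measure.pi fun _ => μ) := by
  have h := slab_cyclic_one (μ := μ) (ν := Measure.dirac ()) (α := fun W (_ : Fin (r + 1) → Unit) => α W)
    (measurable_trivialFibre hK) (fun x (_ : Unit) x' => hKb x x') (measurable_window_fst hα) (fun W _ => hαb W) hN
  rw [integral_prod_unit (μ := μ)
    (fun V : ZMod N → X => α (fun i : Fin (r + 2) => V ((i : ℕ) : ZMod N)) * ∏ t, K (V t) (V (t + 1)))] at h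
  simp only [integral_const, probReal_univ, one_smul] at h
  exact h

/-- **Two slabs** at the sites `0, …, r+1` and `r+a+3, …, 2r+a+4` of `ZMod N`, `N = 2r + a + b' + 6`: the cyclic
integral is the two-insertion cycle with the contracted block kernels on bonds `0` and `a+3`. [folklore] -/
theorem cyclic_two_noFibre (hK : Measurable (uncurry K)) (hKb : ∀ x x', 0 ≤ K x x' ∧ K x x' ≤ Cc) {r : ℕ}
    {α β : (Fin (r + 2) → X) → ℝ} (hα : Measurable α) (hβ : Measurable β) (hαb : ∀ W, |α W| ≤ 1)
    (hβb : ∀ W, |β W| ≤ 1) {a b' N : ℕ} [NeZero N] (hN : N = 2 * r + a + b' + 4 + 2) :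
    ∫ V : ZMod N → X, α (fun i : Fin (r + 2) => V ((i : ℕ) : ZMod N)) *
        β (fun i : Fin (r + 2) => V ((r + a + 3 + (i : ℕ) : ℕ) : ZMod N)) * ∏ t, K (V t) (V (t + 1))
        ∂(Measure.pi fun _ => μ) =
      ∫ V : Fin (1 + (a + 2 + (b' + 1 + 1)) + 1) → X, ∏ t : Fin (1 + (a + 2 + (b' + 1 + 1)) + 1),
        (fun s : ℕ => if s = 0 then (fun u u' : X => ∫ v : Fin r → X, α (Fin.cons u (Fin.snoc v u')) *
            ∏ i : Fin (r + 1), K ((Fin.cons u (Fin.snoc v u') : Fin (r + 2) → X) (Fin.castSucc i))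
              ((Fin.cons u (Fin.snoc v u') : Fin (r + 2) → X) (Fin.succ i)) ∂(Measure.pi fun _ => μ))
          else if s = a + 2 + 1 then (fun u u' : X => ∫ v : Fin r → X, β (Fin.cons u (Fin.snoc v u')) *
            ∏ i : Fin (r + 1), K ((Fin.cons u (Fin.snoc v u') : Fin (r + 2) → X) (Fin.castSucc i))
              ((Fin.cons u (Fin.snoc v u') : Fin (r + 2) → X) (Fin.succ i)) ∂(Measure.pi fun _ => μ))
          else K) (t : ℕ) (V t) (V (t + 1)) ∂(Measure.pi fun _ => μ) := by
  have h := slab_cyclic_two (μ := μ) (ν := Measure.dirac ()) (α := fun W (_ : Fin (r + 1) → Unit) => α W)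
    (β := fun W (_ : Fin (r + 1) → Unit) => β W) (measurable_trivialFibre hK) (fun x (_ : Unit) x' => hKb x x')
    (measurable_window_fst hα) (measurable_window_fst hβ) (fun W _ => hαb W) (fun W _ => hβb W) hN
  rw [integral_prod_unit (μ := μ) (fun V : ZMod N → X => α (fun i : Fin (r + 2) => V ((i : ℕ) : ZMod N)) *
    β (fun i : Fin (r + 2) => V ((r + a + 3 + (i : ℕ) : ℕ) : ZMod N)) * ∏ t, K (V t) (V (t + 1)))] at h
  simp only [integral_const, probReal_univ, one_smul] at h
  exact h

/-! ### Rotations of the cycle -/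

/-- Rotation invariance of the cyclic product measure (shift by `-c`). [folklore] -/
theorem integral_pi_zmod_comp_sub {N : ℕ} [NeZero N] (c : ZMod N) (Φ : (ZMod N → X) → ℝ) :
    ∫ V, Φ (fun t => V (t - c)) ∂(Measure.pi fun _ => μ) = ∫ V, Φ V ∂(Measure.pi fun _ => μ) :=
  integral_pi_comp_perm (ρ := μ) (Equiv.subRight c) Φ

/-- Rotation invariance of the cyclic product measure (shift by `+c`). [folklore] -/
theorem integral_pi_zmod_comp_add {N : ℕ} [NeZero N] (c : ZMod N) (Φ : (ZMod N → X) → ℝ) :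
    ∫ V, Φ (fun t => V (t + c)) ∂(Measure.pi fun _ => μ) = ∫ V, Φ V ∂(Measure.pi fun _ => μ) :=
  integral_pi_comp_perm (ρ := μ) (Equiv.addRight c) Φ

omit [MeasurableSpace X] in
/-- The cyclic Boltzmann product is rotation invariant (shift by `-c`). [folklore] -/
theorem prod_zmod_comp_sub {N : ℕ} [NeZero N] (K : X → X → ℝ) (V : ZMod N → X) (c : ZMod N) :
    ∏ t : ZMod N, K (V (t - c)) (V (t + 1 - c)) = ∏ t : ZMod N, K (V t) (V (t + 1)) :=
  Fintype.prod_equiv (Equiv.subRight c) _ _ fun t => by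
    simp only [Equiv.subRight_apply]; rw [sub_add_eq_add_sub]

omit [MeasurableSpace X] in
/-- The cyclic Boltzmann product is rotation invariant (shift by `+c`). [folklore] -/
theorem prod_zmod_comp_add {N : ℕ} [NeZero N] (K : X → X → ℝ) (V : ZMod N → X) (c : ZMod N) :
    ∏ t : ZMod N, K (V (t + c)) (V (t + 1 + c)) = ∏ t : ZMod N, K (V t) (V (t + 1)) :=
  Fintype.prod_equiv (Equiv.addRight c) _ _ fun t => by
    simp only [Equiv.coe_addRight]; rw [add_right_comm]

/-! ### The window form of a slab-local observable -/

omit [IsProbabilityMeasure μ] in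
/-- **Window form**: an observable of the cyclic configuration which depends only on the sites `t` with `t.val ≤ w`
is a measurable function of the window `(V 0, …, V (w+1))` (extension of the window by a default point). [folklore] -/
theorem exists_window_of_local (x₀ : X) {N : ℕ} [NeZero N] {w : ℕ} {G : (ZMod N → X) → ℝ} (hGm : Measurable G)
    (hGb : ∀ V, |G V| ≤ 1) (hGl : ∀ V V', (∀ t : ZMod N, t.val ≤ w → V t = V' t) → G V = G V') :
    ∃ α : (Fin (w + 2) → X) → ℝ, Measurable α ∧ (∀ W, |α W| ≤ 1) ∧
      ∀ V : ZMod N → X, G V = α (fun i : Fin (w + 2) => V ((i : ℕ) : ZMod N)) := by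
  set ext : (Fin (w + 2) → X) → (ZMod N → X) := fun W t => if h : t.val < w + 2 then W ⟨t.val, h⟩ else x₀ with hext
  have hextm : Measurable ext := by
    refine measurable_pi_lambda _ fun t => ?_
    by_cases h : t.val < w + 2
    · simp only [hext, h, dite_true]; exact measurable_pi_apply _
    · simp only [hext, h, dite_false]; exact measurable_const
  refine ⟨fun W => G (ext W), hGm.comp hextm, fun W => hGb _, fun V => hGl _ _ fun t ht => ?_⟩
  have hlt : t.val < w + 2 := by omega
  simp only [hext, hlt, dite_true]
  rw [ZMod.natCast_zmod_val]

end Literature.Analysis.OperatorTheory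

end
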